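import Literature.NumberTheory.QuadraticFields.FormIdeals
import Literature.NumberTheory.QuadraticFields.BakerLimitFormulaLines
import Mathlib.NumberTheory.NumberField.Units.Basic
import Mathlib.NumberTheory.DirichletCharacter.Basic
import HarnessLib

/-!
# The twisted Dedekind zeta function of a principal imaginary quadratic field as a lattice sum

Topic `NumberTheory/QuadraticFields`, namespace `Literature.NumberTheory.QuadraticFields.Quadratic`
(continuing `FormIdeals.lean`). Everything here is PROVED (one auxiliary definition — the coordinate
bijection `ℤ² ≃ 𝓞 K` of an integral basis `(1, ω)` — and theorems).

For an imaginary quadratic field `K` with `d_K < −4` whose ring of integers is principal, and an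
integral basis `(1, ω)` with `ω² = m + tω` (`d_K = t² + 4m`):

* `norm_intCast_add_intCast_mul` — the norm form `N(x + yω) = x² + txy − my²`;
* `units_eq` — the units of `𝓞 K` are `±1` (`d_K < −4`);
* `span_singleton_eq_span_singleton_iff'` — `(α) = (β) ↔ β = ±α`;
* **`tsum_ideal_eq_half_twistZeta`** — for a Dirichlet character `ψ` and `Re s > 1`,
  `Σ_𝔞 ψ(N𝔞) N𝔞^{−s} = ½ Σ'_{(x,y) ∈ ℤ²} ψ(f(x, y)) f(x, y)^{−s}`, `f = x² + txy − my²`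
  (`= twistZeta (ψ ∘ f) 1 t (−m) s` of `BakerLimitFormulaLines.lean`), the map `(x, y) ↦ (x + yω)`
  being two-to-one onto the non-zero ideals.

This is the passage "the last sum is one half the number of representations of `l` by the forms `f`"
of Baker, *Transcendental Number Theory* (1975), Ch. 5 §2, p. 48 (there via Landau's
*Vorlesungen*, Satz 204, for a full system of forms; here for class number one through ideals),
which with `TwistedDedekindZeta.tsum_twist_eq_LSeries_mul_LSeries` gives Baker's identity (1):
`L(s, χ) L(s, χχ') = ½ Σ_{x,y} χ(f) f^{−s}`.

## References

* [Baker1975] A. Baker, *Transcendental Number Theory* (1975), Ch. 5 §2, eq. (1) (p. 48).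
* [Cox2013] D. A. Cox, *Primes of the form x² + ny²*, 2nd ed. (2013), §7.A–B (norm form, units of
  imaginary quadratic orders).
-/

noncomputable section

open Module NumberField Ideal
open Literature.Barriers.RiemannHypothesis Literature.NumberTheory.QuadraticFields.BakerLimitFormula

namespace Literature.NumberTheory.QuadraticFields.Quadratic

variable {K : Type*} [Field K] [NumberField K]

/-! ### The norm form of an integral basis `(1, ω)` -/

omit [NumberField K] in
/-- **The norm form**: for an integral basis `(1, ω)` of `𝓞 K` with `ω² = m + tω`,
`N_{K/ℚ}(x + yω) = x² + txy − my²` (the determinant of multiplication by `x + yω`,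
`[[x, my], [y, x + ty]]`). [cite: Cox2013, §7.A (norm form of an order)] -/
theorem norm_intCast_add_intCast_mul (b : Basis (Fin 2) ℤ (𝓞 K)) (hb : b 0 = 1) {t m : ℤ}
    (hω : b 1 * b 1 = (m : 𝓞 K) + (t : 𝓞 K) * b 1) (x y : ℤ) :
    Algebra.norm ℤ ((x : 𝓞 K) + (y : 𝓞 K) * b 1) = x ^ 2 + t * x * y - m * y ^ 2 := by
  set α : 𝓞 K := (x : 𝓞 K) + (y : 𝓞 K) * b 1 with hα
  have hα0 : α * b 0 = (x : 𝓞 K) + (y : 𝓞 K) * b 1 := by rw [hb, mul_one]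
  have hα1 : α * b 1 = ((m * y : ℤ) : 𝓞 K) + ((x + t * y : ℤ) : 𝓞 K) * b 1 := by
    rw [hα]
    push_cast
    linear_combination (y : 𝓞 K) * hω
  rw [Algebra.norm_eq_matrix_det b, Matrix.det_fin_two, Algebra.leftMulMatrix_eq_repr_mul,
    Algebra.leftMulMatrix_eq_repr_mul, Algebra.leftMulMatrix_eq_repr_mul,
    Algebra.leftMulMatrix_eq_repr_mul, hα0, hα1, repr_intCast_add_intCast_mul_zero b hb,
    repr_intCast_add_intCast_mul_one b hb, repr_intCast_add_intCast_mul_zero b hb,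
    repr_intCast_add_intCast_mul_one b hb]
  ring

/-- The norm form is positive definite when `t² + 4m < 0`: `4(x² + txy − my²) = (2x + ty)² − (t² + 4m) y²`.
[folklore] -/
theorem normForm_nonneg {t m : ℤ} (hD : t ^ 2 + 4 * m < 0) (x y : ℤ) : 0 ≤ x ^ 2 + t * x * y - m * y ^ 2 := by
  nlinarith [sq_nonneg (2 * x + t * y), sq_nonneg y]

/-- The norm form vanishes only at the origin when `t² + 4m < 0`. [folklore] -/
theorem normForm_eq_zero_iff {t m : ℤ} (hD : t ^ 2 + 4 * m < 0) (x y : ℤ) :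
    x ^ 2 + t * x * y - m * y ^ 2 = 0 ↔ x = 0 ∧ y = 0 := by
  constructor
  · intro h
    have hy : y = 0 := by
      by_contra hy
      have : 0 < y ^ 2 := by positivity
      nlinarith [sq_nonneg (2 * x + t * y)]
    subst hy
    have : x ^ 2 = 0 := by linarith
    exact ⟨pow_eq_zero_iff (n := 2) (by norm_num) |>.mp this, rfl⟩
  · rintro ⟨rfl, rfl⟩; ring

/-- **The absolute norm of a principal ideal through the norm form**:
`N((x + yω)) = x² + txy − my²` (as an integer; `t² + 4m < 0`). [cite: Cox2013, §7.A] -/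
theorem absNorm_span_intCast_add_intCast_mul (b : Basis (Fin 2) ℤ (𝓞 K)) (hb : b 0 = 1) {t m : ℤ}
    (hω : b 1 * b 1 = (m : 𝓞 K) + (t : 𝓞 K) * b 1) (hD : t ^ 2 + 4 * m < 0) (x y : ℤ) :
    ((absNorm (span {(x : 𝓞 K) + (y : 𝓞 K) * b 1}) : ℕ) : ℤ) = x ^ 2 + t * x * y - m * y ^ 2 := by
  rw [Ideal.absNorm_span_singleton, norm_intCast_add_intCast_mul b hb hω,
    Int.natAbs_of_nonneg (normForm_nonneg hD x y)]

/-! ### Units and generators -/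

omit [NumberField K] in
/-- **The units of an imaginary quadratic field with `d_K < −4` are `±1`** (with `ω² = m + tω`,
`d_K = t² + 4m`: a unit `x + yω` has `(2x + ty)² + |d_K| y² = 4`, forcing `y = 0`, `x = ±1`).
[cite: Cox2013, §7.A (units of imaginary quadratic orders)] -/
theorem units_eq (b : Basis (Fin 2) ℤ (𝓞 K)) (hb : b 0 = 1) {t m : ℤ}
    (hω : b 1 * b 1 = (m : 𝓞 K) + (t : 𝓞 K) * b 1) (hD : t ^ 2 + 4 * m < -4) (u : (𝓞 K)ˣ) :
    (u : 𝓞 K) = 1 ∨ (u : 𝓞 K) = -1 := by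
  obtain ⟨x, y, hxy⟩ : ∃ x y : ℤ, (u : 𝓞 K) = x + y * b 1 := ⟨_, _, eq_repr_add_repr_mul_of_basis b hb _⟩
  have hunit : IsUnit (Algebra.norm ℤ (u : 𝓞 K)) := u.isUnit.map _
  rw [hxy, norm_intCast_add_intCast_mul b hb hω, Int.isUnit_iff] at hunit
  have hnn := normForm_nonneg (by linarith : t ^ 2 + 4 * m < 0) x y
  have h1 : x ^ 2 + t * x * y - m * y ^ 2 = 1 := by rcases hunit with h | h <;> linarith
  have hy : y = 0 := by
    by_contra hy
    have : 1 ≤ y ^ 2 := by nlinarith [Int.one_le_abs hy, sq_abs y]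
    nlinarith [sq_nonneg (2 * x + t * y)]
  subst hy
  have hx : x = 1 ∨ x = -1 := by
    have h2 : x ^ 2 = 1 := by simpa using h1
    have h3 : (x - 1) * (x + 1) = 0 := by linear_combination h2
    rcases mul_eq_zero.mp h3 with h | h
    · left; linarith
    · right; linarith
  rcases hx with rfl | rfl
  · left; rw [hxy]; push_cast; ring
  · right; rw [hxy]; push_cast; ring

omit [NumberField K] in
/-- **`(α) = (β)` iff `β = ±α`** in the ring of integers of an imaginary quadratic field with
`d_K < −4`. [folklore] -/
theorem span_singleton_eq_span_singleton_iff' (b : Basis (Fin 2) ℤ (𝓞 K)) (hb : b 0 = 1) {t m : ℤ}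
    (hω : b 1 * b 1 = (m : 𝓞 K) + (t : 𝓞 K) * b 1) (hD : t ^ 2 + 4 * m < -4) (α β : 𝓞 K) :
    span ({α} : Set (𝓞 K)) = span {β} ↔ β = α ∨ β = -α := by
  rw [Ideal.span_singleton_eq_span_singleton]
  constructor
  · rintro ⟨u, rfl⟩
    rcases units_eq b hb hω hD u with h | h
    · left; rw [h, mul_one]
    · right; rw [h, mul_neg_one]
  · rintro (rfl | rfl)
    · exact Associated.refl _
    · exact ⟨-1, by simp⟩

/-! ### The coordinate bijection `ℤ² ≃ 𝓞 K` -/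

/-- The coordinates of an integral basis `(1, ω)`: `(x, y) ↦ x + yω` is a bijection `ℤ² ≃ 𝓞 K`.
[folklore] -/
def coordEquiv (b : Basis (Fin 2) ℤ (𝓞 K)) (hb : b 0 = 1) : ℤ × ℤ ≃ 𝓞 K where
  toFun p := (p.1 : 𝓞 K) + (p.2 : 𝓞 K) * b 1
  invFun α := (b.repr α 0, b.repr α 1)
  left_inv _ := Prod.ext (repr_intCast_add_intCast_mul_zero b hb _ _)
    (repr_intCast_add_intCast_mul_one b hb _ _)
  right_inv α := (eq_repr_add_repr_mul_of_basis b hb α).symm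

omit [NumberField K] in
/-- Unfolding lemma. [folklore] -/
theorem coordEquiv_apply (b : Basis (Fin 2) ℤ (𝓞 K)) (hb : b 0 = 1) (p : ℤ × ℤ) :
    coordEquiv b hb p = (p.1 : 𝓞 K) + (p.2 : 𝓞 K) * b 1 := rfl

/-! ### The twisted Dedekind zeta function as a lattice sum -/

/-- The real form `x² + txy − my²` (`a = 1`, `b = t`, `c = −m`) is positive definite when
`t² + 4m < 0`. [folklore] -/
theorem isPosDefForm_one {t m : ℤ} (hD : t ^ 2 + 4 * m < 0) : IsPosDefForm 1 (t : ℝ) (-m : ℝ) := by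
  refine ⟨one_pos, ?_⟩
  have : ((t ^ 2 + 4 * m : ℤ) : ℝ) < 0 := by exact_mod_cast hD
  push_cast at this
  linarith

/-- **The twisted Dedekind zeta function of a principal imaginary quadratic field is half a twisted
Epstein zeta function**: for `𝓞 K` principal with `d_K < −4`, an integral basis `(1, ω)` with
`ω² = m + tω`, a Dirichlet character `ψ` and `Re s > 1`,
`Σ_𝔞 ψ(N𝔞) N𝔞^{−s} = ½ Σ'_{(x,y)} ψ(f(x, y)) f(x, y)^{−s}`, `f = x² + txy − my²`
(the map `(x, y) ↦ (x + yω)` is onto the ideals and two-to-one off the origin). Baker, Ch. 5 §2: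
"the last sum is one half the number of representations of `l` by the forms `f`".
[cite: Baker1975, Ch. 5 §2 eq. (1)] -/
theorem tsum_ideal_eq_half_twistZeta [IsPrincipalIdealRing (𝓞 K)] (b : Basis (Fin 2) ℤ (𝓞 K))
    (hb : b 0 = 1) {t m : ℤ} (hω : b 1 * b 1 = (m : 𝓞 K) + (t : 𝓞 K) * b 1) (hD : t ^ 2 + 4 * m < -4)
    {N : ℕ} [NeZero N] (ψ : DirichletCharacter ℂ N) {s : ℂ} (hs : 1 < s.re) :
    ∑' I : Ideal (𝓞 K), ψ (absNorm I) * ((absNorm I : ℕ) : ℂ) ^ (-s) =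
      1 / 2 * twistZeta (fun p : ℤ × ℤ => ψ ((p.1 ^ 2 + t * p.1 * p.2 - m * p.2 ^ 2 : ℤ) : ZMod N))
        1 t (-m) s := by
  classical
  have hs0 : s ≠ 0 := fun h => by rw [h, Complex.zero_re] at hs; linarith
  have hD' : t ^ 2 + 4 * m < 0 := by linarith
  have hpos := isPosDefForm_one hD'
  set e := coordEquiv b hb with he
  set G : Ideal (𝓞 K) → ℂ := fun I => ψ (absNorm I) * ((absNorm I : ℕ) : ℂ) ^ (-s) with hG
  set F : 𝓞 K → ℂ := fun α => G (span {α}) with hF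
  set w : ℤ × ℤ → ℂ := fun p => ψ ((p.1 ^ 2 + t * p.1 * p.2 - m * p.2 ^ 2 : ℤ) : ZMod N) with hw
  -- the terms agree along `e`
  have hterm : ∀ p : ℤ × ℤ, twistTerm w 1 t (-m) s p = F (e p) := by
    intro p
    simp only [twistTerm, epsteinTerm, hF, hG, he, coordEquiv_apply]
    by_cases hp : p = 0
    · rw [if_pos hp, hp]
      simp only [Prod.fst_zero, Prod.snd_zero, Int.cast_zero, zero_mul, add_zero, mul_zero,
        Ideal.span_singleton_eq_bot.mpr rfl, Ideal.absNorm_bot, Nat.cast_zero,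
        Complex.zero_cpow (neg_ne_zero.mpr hs0)]
    · rw [if_neg hp]
      have hN := absNorm_span_intCast_add_intCast_mul b hb hω hD' p.1 p.2
      set n : ℕ := absNorm (span {(p.1 : 𝓞 K) + (p.2 : 𝓞 K) * b 1}) with hn
      have h1 : ((n : ℕ) : ZMod N) = ((p.1 ^ 2 + t * p.1 * p.2 - m * p.2 ^ 2 : ℤ) : ZMod N) := by
        rw [← hN, Int.cast_natCast]
      have h2 : ((n : ℕ) : ℂ) = (((bqfEval 1 (t : ℝ) (-m : ℝ) p) : ℝ) : ℂ) := by
        have : (bqfEval 1 (t : ℝ) (-m : ℝ) p) = ((p.1 ^ 2 + t * p.1 * p.2 - m * p.2 ^ 2 : ℤ) : ℝ) := by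
          unfold bqfEval; push_cast; ring
        rw [this, ← hN]
        norm_cast
      rw [h1, h2, hw]
  -- hence the twisted Epstein sum is `Σ_α F(α)`
  have hsumT : Summable (twistTerm w 1 t (-m) s) :=
    (summable_norm_twistTerm hpos (fun p => DirichletCharacter.norm_le_one ψ _) hs).of_norm
  have hsumF : Summable F := by
    refine (e.summable_iff).mp (hsumT.congr fun p => hterm p)
  have hZ : twistZeta w 1 t (-m) s = ∑' α : 𝓞 K, F α := by
    unfold twistZeta
    rw [← e.tsum_eq F]
    exact tsum_congr hterm
  -- and `Σ_α F(α) = 2 Σ_𝔞 G(𝔞)`: the fibres of `α ↦ (α)` are `{±α₀}` (or `{0}`)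
  have hfib := hsumF.hasSum.tsum_fiberwise (fun α : 𝓞 K => span ({α} : Set (𝓞 K)))
  have hinner : ∀ I : Ideal (𝓞 K),
      (∑' α : ↥((fun α : 𝓞 K => span ({α} : Set (𝓞 K))) ⁻¹' {I}), F α) = 2 * G I := by
    intro I
    obtain ⟨α₀, rfl⟩ : ∃ α₀ : 𝓞 K, I = span {α₀} :=
      ⟨_, (IsPrincipalIdealRing.principal I).span_singleton_generator.symm⟩
    rw [tsum_subtype ((fun α : 𝓞 K => span ({α} : Set (𝓞 K))) ⁻¹' {span {α₀}}) F]
    have hset : ((fun α : 𝓞 K => span ({α} : Set (𝓞 K))) ⁻¹' {span {α₀}}) = {α₀, -α₀} := by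
      ext α
      simp only [Set.mem_preimage, Set.mem_singleton_iff, Set.mem_insert_iff]
      rw [span_singleton_eq_span_singleton_iff' b hb hω hD]
      constructor
      · rintro (h | h)
        · exact Or.inl h.symm
        · exact Or.inr (by rw [h, neg_neg])
      · rintro (rfl | rfl)
        · exact Or.inl rfl
        · exact Or.inr (neg_neg _).symm
    rw [hset]
    by_cases hα : α₀ = 0
    · subst hα
      rw [neg_zero, Set.pair_eq_singleton, tsum_eq_single 0 (fun α hα => Set.indicator_of_notMem
        (by simpa using hα) F), Set.indicator_of_mem (Set.mem_singleton _)]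
      simp only [hF, hG, Ideal.span_singleton_eq_bot.mpr rfl, Ideal.absNorm_bot, Nat.cast_zero,
        Complex.zero_cpow (neg_ne_zero.mpr hs0), mul_zero]
    · have hne : α₀ ≠ -α₀ := fun h => hα (by
        have : (2 : 𝓞 K) * α₀ = 0 := by linear_combination h
        exact (mul_eq_zero.mp this).resolve_left (by norm_num))
      rw [tsum_eq_sum (s := {α₀, -α₀}) (fun α hα => Set.indicator_of_notMem (by simpa using hα) F),
        Finset.sum_pair hne, Set.indicator_of_mem (by simp), Set.indicator_of_mem (by simp)]
      simp only [hF, hG, Ideal.span_singleton_neg]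
      ring
  have hfib' : HasSum (fun I : Ideal (𝓞 K) => 2 * G I) (∑' α : 𝓞 K, F α) := by
    have hfun : (fun I : Ideal (𝓞 K) =>
        ∑' α : ↥((fun α : 𝓞 K => span ({α} : Set (𝓞 K))) ⁻¹' {I}), F α) = fun I => 2 * G I :=
      funext hinner
    rw [← hfun]
    exact hfib
  have h2 : (∑' α : 𝓞 K, F α) = 2 * ∑' I : Ideal (𝓞 K), G I := by
    rw [← hfib'.tsum_eq, tsum_mul_left]
  rw [hZ, h2]
  ring

end Literature.NumberTheory.QuadraticFields.Quadratic
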